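import Summits.Ventures.DiscreteObjects.PP12.FlagTenConjunctC3
import Summits.Ventures.DiscreteObjects.PP12.FlagTenConjunctC1Fin

/-!
# The `f = 10` flag-cell orbit data: conjunct 9 ((C3)) of `IsFlagTenOrbitMatrix`, transported (kernel; Step D)
Framing: lottery ticket; floor = certified bounds/negative ranges.

Cell pub-namedobj (venture DiscreteObjects), target (M), designs gen 14 (HOME designs-g13 FAMILY-FLAG7X §7c). For the orbit data
`D := flagTenDataOfPlane …` read off a putative projective plane of order 12 with a flag-type collineation `σ`, `σ³ = 1`, `f = 10`:
conjunct 9, `∀ i j t, #{k : D.β k j (D.C k i) = t} + 2·[D.γ j i = t] + [D.γ j (D.φ i) = t] = 3` (**`flagTenDataOfPlane_C3`**) — the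
transport of `FlagTenConjunctC3.vertex_tpoint_count` along `eTri`/`eFixL`/`eFixP`/`eOrbOn`/`eLOrb`. No `sorry`, no new axioms.
-/

namespace Summit.Ventures.DiscreteObjects.PP12

open Configuration Finset
open scoped Classical

namespace Collineation

variable {P L : Type*} [Membership P L] [ProjectivePlane P L] [Fintype P] [Fintype L] (σ : Collineation P L)

section Data

variable {l : L} {c : P} (hl : σ.onLines l = l) (hc : σ.onPoints c = c) (hcl : c ∈ l)
  (hP : ∀ p : P, σ.onPoints p = p → p ∈ l) (hL : ∀ m : L, σ.onLines m = m → c ∈ m) (h12 : ProjectivePlane.order P L = 12)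
  (hq : σ.onPoints ^ 3 = 1) (hf : fixedCard σ.onPoints = 10) {u₀ : L} (hcu₀ : c ∈ u₀) (hu₀ : σ.onLines u₀ ≠ u₀)

set_option maxHeartbeats 400000 in
/-- **Conjunct 9 ((C3)).** (Heartbeats raised for the lane build's headroom, as for `flagTenDataOfPlane_C4`.) -/
theorem flagTenDataOfPlane_C3 (i : Fin 12) (j : Fin 9) (t : Fin 4) :
    (univ.filter fun k : Fin 9 => (σ.flagTenDataOfPlane hl hc hcl hP hL h12 hq hf hcu₀ hu₀).β k j
        ((σ.flagTenDataOfPlane hl hc hcl hP hL h12 hq hf hcu₀ hu₀).C k i) = t).card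
      + 2 * flagInd ((σ.flagTenDataOfPlane hl hc hcl hP hL h12 hq hf hcu₀ hu₀).γ j i = t)
      + flagInd ((σ.flagTenDataOfPlane hl hc hcl hP hL h12 hq hf hcu₀ hu₀).γ j
          ((σ.flagTenDataOfPlane hl hc hcl hP hL h12 hq hf hcu₀ hu₀).φ i) = t) = 3 := by
  set D := σ.flagTenDataOfPlane hl hc hcl hP hL h12 hq hf hcu₀ hu₀ with hD
  set e := eTri (P := P) h12 hcu₀ with he
  set eK := σ.eFixP hl hc hf with heK
  set m := σ.eFixL hl hc hf j with hm
  set eO := σ.eOrbOn hc hcl hP hL h12 hq m with heO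
  set x := e i with hx
  -- a representative z of the orbit t on m
  obtain ⟨z, hz, hzeq⟩ := mem_image.1 (eO t).2
  rw [mem_filter] at hz
  obtain ⟨-, hzm, hzc⟩ := hz
  -- unfold γ, β, C, φ
  have hγ : ∀ i₀ : Fin 12, D.γ j i₀ = eO.symm ⟨σ.gammaOrb l c m.1 (e i₀).1,
      (σ.gammaOrb_mem hl hc hP hL (σ.exterior_of_mem_cline hL hcu₀ hu₀ (e i₀).2.1 (e i₀).2.2) m.2.1).1⟩ := fun i₀ => rfl
  have hC : ∀ (k : Fin 9) (i₀ : Fin 12), D.C k i₀ = (σ.eLOrb hl hcl hP hL h12 hq (eK k)).symm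
      ⟨σ.cOrb l (eK k).1 (e i₀).1,
        (σ.cOrb_mem hl hP (σ.exterior_of_mem_cline hL hcu₀ hu₀ (e i₀).2.1 (e i₀).2.2) (eK k).2.1).1⟩ := fun k i₀ => rfl
  have hβ : ∀ (k : Fin 9) (tt : Fin 4), D.β k j tt = eO.symm
      ⟨σ.betaOrb c m.1 ((σ.eLOrb hl hcl hP hL h12 hq (eK k)) tt).1, by
          obtain ⟨b₁, hb₁, hb₁eq⟩ := mem_image.1 ((σ.eLOrb hl hcl hP hL h12 hq (eK k)) tt).2
          rw [mem_filter] at hb₁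
          rw [← hb₁eq]
          exact σ.betaOrb_mem hc hcl hP hL hq (eK k).2.1 (eK k).2.2 hb₁.2.1 hb₁.2.2 m.2.1 m.2.2⟩ := fun k tt => rfl
  have hφ : ∀ i₀ : Fin 12, (e (D.φ i₀)).1 = σ.phiVertex l c u₀ (e i₀).1 := by
    intro i₀
    change (e ((((e.trans (σ.phiEquiv hl hc hcl hP hL h12 hq hf hcu₀ hu₀)).trans e.symm)) i₀)).1 = _
    simp only [Equiv.trans_apply, Equiv.apply_symm_apply]
    rfl
  -- γ-conditions at plane level
  have hiffγ : ∀ i₀ : Fin 12, D.γ j i₀ = t ↔ σ.gammaOrb l c m.1 (e i₀).1 = orb3 σ.onPoints z := by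
    intro i₀
    rw [hγ]
    constructor
    · intro h1
      have := congrArg (fun s => (eO s).1) h1; simp at this; rw [this, hzeq]
    · intro h1
      apply eO.injective; rw [Equiv.apply_symm_apply]; apply Subtype.ext
      change σ.gammaOrb l c m.1 (e i₀).1 = (eO t).1; rw [h1, hzeq]
  have hI1 : flagInd (D.γ j i = t) = flagInd (σ.gammaOrb l c m.1 x.1 = orb3 σ.onPoints z) := by
    unfold flagInd
    by_cases h : σ.gammaOrb l c m.1 x.1 = orb3 σ.onPoints z
    · rw [if_pos h, if_pos ((hiffγ i).2 h)]
    · rw [if_neg h, if_neg (fun h' => h ((hiffγ i).1 h'))]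
  have hI2 : flagInd (D.γ j (D.φ i) = t) = flagInd (σ.gammaOrb l c m.1 (σ.phiVertex l c u₀ x.1) = orb3 σ.onPoints z) := by
    unfold flagInd
    rw [← hφ i]
    by_cases h : σ.gammaOrb l c m.1 (e (D.φ i)).1 = orb3 σ.onPoints z
    · rw [if_pos h, if_pos ((hiffγ (D.φ i)).2 h)]
    · rw [if_neg h, if_neg (fun h' => h ((hiffγ (D.φ i)).1 h'))]
  -- the filter at plane level
  have hset : (univ.filter fun k : Fin 9 => D.β k j (D.C k i) = t)
      = univ.filter fun k : Fin 9 => σ.betaOrb c m.1 (σ.cOrb l (eK k).1 x.1) = orb3 σ.onPoints z := by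
    ext k
    simp only [mem_filter, mem_univ, true_and]
    rw [hβ, hC, Equiv.apply_symm_apply]
    constructor
    · intro h1
      have := congrArg (fun s => (eO s).1) h1; simp at this; rw [this, hzeq]
    · intro h1
      apply eO.injective; rw [Equiv.apply_symm_apply]; apply Subtype.ext
      change σ.betaOrb c m.1 (σ.cOrb l (eK k).1 x.1) = (eO t).1; rw [h1, hzeq]
  rw [hset, hI1, hI2]
  have h2 := σ.card_filter_eFixP hl hc hf (fun y => σ.betaOrb c m.1 (σ.cOrb l y x.1) = orb3 σ.onPoints z)
  rw [← heK] at h2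
  have h3 := σ.vertex_tpoint_count hl hc hcl hP hL h12 hq hf hcu₀ hu₀ x.2.1 x.2.2 m.2.1 m.2.2 hzm hzc
  have hJ : (univ.filter fun k : Fin 9 => σ.betaOrb c m.1 (σ.cOrb l (eK k).1 x.1) = orb3 σ.onPoints z).card
      = (univ.filter fun y : P => σ.onPoints y = y ∧ y ≠ c ∧ σ.betaOrb c m.1 (σ.cOrb l y x.1) = orb3 σ.onPoints z).card := by
    convert h2 using 2 <;> (ext y; simp only [mem_filter, mem_univ, true_and])
  rw [hJ]
  exact h3

end Data

end Collineation

end Summit.Ventures.DiscreteObjects.PP12
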